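import Summits.BirchSwinnertonDyer.BirchSwinnertonDyer.Theorems.EisensteinPrimesFullDescentOrdinaryFrobenius
import HarnessLib

/-!
# Crux `GoodLatticeBDPValue` (stmt-BirchSwinnertonDyer-19032), line `halves`, AN-3 Stub B road — brick F3b′:
# Serre's lines at levels `p`, `p²` at a good ORDINARY place above `p`, PACKAGED WITH THE FROBENIUS BOUND

Width seat bsd-line-x1-p1-w3 (gen 4). HONEST FRAMING (cell `bsd-eis`, run/shared/lean/pub/bsd-eis/):
TOOL THEOREM ONLY (no `def`, no named fact, no `sorry`); nothing about a summit statement,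
Keller–Yin Thm. 2.2.2 or crux 2 is proved here; 0 stubs / cells / labels move.

WHY. Brick F3b (`exists_lines_geomTorsion_sq_of_not_dvd_frobeniusTraceAt`, p654618) packages the
kernel-of-reduction lines `Λ₁ ≤ E[p]`, `Λ₂ ≤ E[p²]` of the good local model but hides the reduction
map `f`; brick F3c (`pow_le_two_mul_residueCard_add_one_of_forall_apply_smul_eq`, p655429) is the
Frobenius bound stated for that explicit `f`. The assembly of Theorem T′ (road memo
`HOME/line-x1-p1-w3-g4/AN3-StubB-elementary-road.md`, step A5) needs both AT ONCE, for the same `f`: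
this file re-packages F3b with one more clause — «if the decomposition group acts trivially on
`E[p²]/Λ₂` then `p² ≤ 2·q_v + 1`» — so that no consumer ever sees `f`.

* `exists_lines_geomTorsion_sq_with_bound` — the eleven clauses of F3b plus the Frobenius bound.

References: [SerreInventiones1972] §1.11 Prop. 11 and Cor.; [GreenbergLNM1716] §1 p. 62, §2 p. 70;
[SilvermanAEC2009] VII.§2, Ex. 5.10.
-/

noncomputable section

open scoped Classical NNReal NumberField AddSubgroup
open NumberField IsDedekindDomain Polynomial

set_option autoImplicit false
set_option linter.dupNamespace false

namespace Summit.BirchSwinnertonDyer.BirchSwinnertonDyer.Theorems.FullDescentOrdinary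

open _root_.WeierstrassCurve Literature.NumberTheory.EllipticCurves Literature.NumberTheory.GaloisRepresentations
  Field IsDedekindDomain.HeightOneSpectrum

/-- **Serre's lines at levels `p`, `p²` with the Frobenius bound, packaged.** For an elliptic curve
`E` over a number field `K`, a prime `p` and a place `v ∣ p` of good ORDINARY reduction: subgroups
`Λ₁ ≤ E[p]`, `Λ₂ ≤ E[p²]` of orders `p`, `p²` (`Λ₂` cyclic, `Λ₂ ∩ E[p] = Λ₁`), stable under the
decomposition group, inertia trivial on the quotients, AND: if the whole decomposition group acts
trivially on `E[p²]/Λ₂` then `p² ≤ 2·#k_v + 1` (bricks F3b + F3c for the same reduction map).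
[cite: SerreInventiones1972, §1.11 Prop. 11 and Cor.] [cite: GreenbergLNM1716, §1 p. 62, §2 p. 70] -/
theorem exists_lines_geomTorsion_sq_with_bound {K : Type} [Field K] [NumberField K]
    (W : WeierstrassCurve K) [W.IsElliptic] (p : ℕ) [hp : Fact p.Prime]
    (v : HeightOneSpectrum (𝓞 K)) (hpv : (p : 𝓞 K) ∈ v.asIdeal) (hgood : W.HasGoodReductionAt v)
    (hord : ¬ ((p : ℤ) ∣ W.frobeniusTraceAt v)) :
    ∃ Λ₁ Λ₂ : AddSubgroup (geomPoints W),
      Λ₁ ≤ geomTorsion W p ∧ Nat.card Λ₁ = p ∧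
      Λ₂ ≤ geomTorsion W ((p ^ 2 : ℕ) : ℤ) ∧ Nat.card Λ₂ = p ^ 2 ∧
      Λ₂ ⊓ geomTorsion W p = Λ₁ ∧
      (∃ x ∈ Λ₂, addOrderOf x = p ^ 2 ∧ ∀ y ∈ Λ₂, ∃ c : ℕ, y = c • x) ∧
      (∀ (τ : absoluteGaloisGroup (v.adicCompletion K)), ∀ x ∈ Λ₁,
        absGaloisRestrict K (v.adicCompletion K) τ • x ∈ Λ₁) ∧
      (∀ (τ : absoluteGaloisGroup (v.adicCompletion K)), ∀ x ∈ Λ₂,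
        absGaloisRestrict K (v.adicCompletion K) τ • x ∈ Λ₂) ∧
      (∀ τ ∈ absInertia (v.adicCompletion K), ∀ x ∈ geomTorsion W p,
        absGaloisRestrict K (v.adicCompletion K) τ • x - x ∈ Λ₁) ∧
      (∀ τ ∈ absInertia (v.adicCompletion K), ∀ x ∈ geomTorsion W ((p ^ 2 : ℕ) : ℤ),
        absGaloisRestrict K (v.adicCompletion K) τ • x - x ∈ Λ₂) ∧
      ((∀ (τ : absoluteGaloisGroup (v.adicCompletion K)), ∀ x ∈ geomTorsion W ((p ^ 2 : ℕ) : ℤ),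
        absGaloisRestrict K (v.adicCompletion K) τ • x - x ∈ Λ₂) → p ^ 2 ≤ 2 * v.residueCard + 1) := by
  obtain ⟨w, hw, φ, Φ₀, hX, _, hΔO, hΦ₀⟩ := exists_goodReduction_localModel W v hgood
  set f : geomPoints W →+ (((W.localMinimalIntegralModel v).map φ).map
      (IsLocalRing.residue w.valuationSubring)).toAffine.Point :=
    (goodReductionHom ((W.localMinimalIntegralModel v).map φ)
      (Valuation.valuationSubring.integers w) hΔO).comp
      (((Φ₀.trans (Affine.Point.congrEquiv hX)).toAddMonoidHom).comp
        (pointsMap W (v.adicCompletion K))) with hfdef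
  obtain ⟨hstab, hinv, hcard⟩ := goodReduction_reduction_line W p v hpv hgood hord hw hΔO hX Φ₀ hΦ₀
    f (fun a ↦ rfl)
  obtain ⟨hcard2, x₀, hx₀, hx₀ord, hx₀gen⟩ :=
    natCard_ker_inf_geomTorsion_pow W p v hpv hgood hord hw hΔO hX Φ₀ f (fun a ↦ rfl) 2
  have hst : ∀ (n : ℤ) (τ : absoluteGaloisGroup (v.adicCompletion K)), ∀ x ∈ f.ker ⊓ geomTorsion W n,
      absGaloisRestrict K (v.adicCompletion K) τ • x ∈ f.ker ⊓ geomTorsion W n := by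
    intro n τ x hx
    obtain ⟨hx1, hx2⟩ := AddSubgroup.mem_inf.mp hx
    refine AddSubgroup.mem_inf.mpr ⟨?_, ?_⟩
    · rw [AddMonoidHom.mem_ker] at hx1 ⊢
      exact hstab τ x hx1
    · rw [mem_torsionBy_iff] at hx2 ⊢
      rw [smul_comm n, hx2, smul_zero]
  have hin : ∀ (n : ℤ), ∀ τ ∈ absInertia (v.adicCompletion K), ∀ x ∈ geomTorsion W n,
      absGaloisRestrict K (v.adicCompletion K) τ • x - x ∈ f.ker ⊓ geomTorsion W n := by
    intro n τ hτ x hx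
    refine AddSubgroup.mem_inf.mpr ⟨?_, ?_⟩
    · rw [AddMonoidHom.mem_ker, map_sub, hinv τ hτ, sub_self]
    · rw [mem_torsionBy_iff] at hx ⊢
      rw [smul_sub, smul_comm n, hx, smul_zero, sub_self]
  have hle : geomTorsion W (p : ℤ) ≤ geomTorsion W ((p ^ 2 : ℕ) : ℤ) := by
    intro x hx
    rw [mem_torsionBy_iff] at hx ⊢
    rw [Nat.cast_pow, pow_two, mul_smul, hx, smul_zero]
  refine ⟨f.ker ⊓ geomTorsion W p, f.ker ⊓ geomTorsion W ((p ^ 2 : ℕ) : ℤ), inf_le_right, hcard,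
    inf_le_right, hcard2, by rw [inf_assoc, inf_eq_right.mpr hle], ⟨x₀, hx₀, hx₀ord, hx₀gen⟩,
    hst _, hst _, hin _, hin _, fun htriv ↦ ?_⟩
  -- the Frobenius bound (brick F3c) for the same `f`
  refine pow_le_two_mul_residueCard_add_one_of_forall_apply_smul_eq W p v hpv hgood hord hw hΔO hX Φ₀
    hΦ₀ f (fun a ↦ rfl) 2 fun τ x hx ↦ ?_
  have h := (AddSubgroup.mem_inf.mp (htriv τ x hx)).1
  rw [AddMonoidHom.mem_ker, map_sub, sub_eq_zero] at h
  exact h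

end Summit.BirchSwinnertonDyer.BirchSwinnertonDyer.Theorems.FullDescentOrdinary
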